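import Summits.Ventures.HodgeRepro.FaceReduce

/-!
# The real-place half of the seesaw condition N1 is automatic on every face (T3.3, Lean where elementary)

Blind re-derivation cell `pub-hodge-repro`, Tier 3, seat `t3-p2` (prover-pub-hodge-repro-t3-p2-g0-0), sub-goal T3.3
of `route/TIER3.md` v0.1 (the witness `X` at `n = 3`).  Target tree path
`lean/Summits/Ventures/HodgeRepro/T3SeesawSigns.lean`.  Imports: the typer's `FaceReduce` (faces, `SumTwo`) and
through it `CMType` (`IsComplexConj`, `IsCMType`) — Mathlib + `Summits/Ventures/HodgeRepro/` only.

## The statement on paper (`proofs/t3-p2/R3R4-INSTANTIATION.md` §4, the seat's N1 analysis)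

A face is a family of four CM types `T i` of the Galois CM field `E′` (group model `(G, c)`, `CMType.lean`) with
`SumTwo`: every embedding lies in exactly two corners.  For the Weil-class component `w_s` the closer C7
(ROUTE.md §4 item 2) pairs the two corners containing `s` against the two containing `c * s`; each corner `i` with
eigen-embedding `x ∈ T i` is realised on the Picard modular surface `X` by the theta lift of Liu's character
`μ_{i,x}` with CM type `Φ_{μ_{i,x}} = x · (T i)⁻¹` (Liu 2021 Def 4.3 / Def 4.5 + Shimura 1998 §8.3; the `(1,0)`-summand of
Prop 4.13 at the ball place `τ′ = 1` is the one with `τ′ ∈ Φ_μ`, Lemma 10.2(2)), from a skew-hermitian line `e_{i,x} ∈ E′^{−,×}`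
which is `μ_{i,x}`-admissible (Def 4.12): `Im g(e_{i,x}) < 0` exactly for the embeddings `g ∈ Φ_{μ_{i,x}}`, i.e.
`g⁻¹ * x ∈ T i`.  The seesaw of C7 needs the two hermitian planes `W = W_{i₁} ⊕ W_{i₂}` (corners containing `s`) and
`W′ = W_{i₃} ⊕ W_{i₄}` (corners containing `c * s`) to be isometric (N1); by Landherr's theorem this is «equal
signatures at every real place» + «equal discriminants in `F′^×/N(E′^×)`».  At the real place of the embedding
`g` the number of negative lines among the corners containing `s` is `#{i : s ∈ T i ∧ u ∈ T i}`, `u := g⁻¹ * s`,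
and among the corners containing `c * s` it is `#{i : s ∉ T i ∧ u ∉ T i}` (the line of `(i, c * s)` is negative at
`g` iff `g⁻¹ * c * s ∈ T i` iff `u ∉ T i`, `T i` being a CM type).  `sumTwo_card_inter_eq_card_compl_inter` shows these
two numbers are EQUAL for every `s`, `u` — so the signature half of N1 holds on every face with no choice made; the
discriminant half is then met by the choice `e_{i₄} := e_{i₁} e_{i₂} / e_{i₃}` (paper note §4).

Nothing here says anything about the status of the Hodge conjecture for CM abelian varieties, which is NOT proved.
-/

set_option autoImplicit false

open Finset

namespace HodgeRepro

namespace T3.SeesawSigns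

variable {G : Type*} [Group G] [Fintype G] [DecidableEq G]
variable {ι : Type*} [Fintype ι]

/-- A face has exactly four corners: double counting `Σ_i |T i| = Σ_x #{i : x ∈ T i} = 2 |G|` with `2 |T i| = |G|`
(`IsCMType.two_mul_card`). -/
theorem card_eq_four_of_sumTwo {c : G} (hc : IsComplexConj c) (T : ι → Finset G)
    (hT : ∀ i, IsCMType c (T i)) (h2 : SumTwo T) : Fintype.card ι = 4 := by
  have hG : 0 < Fintype.card G := Fintype.card_pos
  -- `Σ_i 2 |T i| = |ι| |G|`
  have hsum : ∑ i, 2 * (T i).card = Fintype.card ι * Fintype.card G := by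
    rw [sum_congr rfl fun i _ => (hT i).two_mul_card hc, sum_const, card_univ, smul_eq_mul]
  -- `Σ_i |T i| = Σ_x #{i : x ∈ T i} = 2 |G|`
  have hdouble : ∑ i, (T i).card = 2 * Fintype.card G := by
    have h1 : ∀ i, (T i).card = ∑ x : G, if x ∈ T i then 1 else 0 := fun i => by
      rw [← card_filter]
      congr 1
      ext x
      simp
    have h2' : ∀ x : G, (univ.filter fun i => x ∈ T i).card = ∑ i, if x ∈ T i then 1 else 0 :=
      fun x => card_filter _ _
    calc ∑ i, (T i).card = ∑ i, ∑ x : G, if x ∈ T i then 1 else 0 := sum_congr rfl fun i _ => h1 i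
      _ = ∑ x : G, ∑ i, if x ∈ T i then 1 else 0 := sum_comm
      _ = ∑ x : G, (univ.filter fun i => x ∈ T i).card := sum_congr rfl fun x _ => (h2' x).symm
      _ = ∑ x : G, 2 := sum_congr rfl fun x _ => h2 x
      _ = 2 * Fintype.card G := by rw [sum_const, card_univ, smul_eq_mul, mul_comm]
  have hfin : Fintype.card ι * Fintype.card G = 4 * Fintype.card G := by
    rw [← hsum, ← mul_sum, hdouble]
    ring
  exact Nat.eq_of_mul_eq_mul_right hG hfin

omit [Group G] [Fintype G] in
/-- **N1, the real-place half, on the group model.**  For a face `T` (`SumTwo`, four corners) and embeddings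
`s`, `u`: the number of corners containing both `s` and `u` equals the number of corners containing neither. -/
theorem sumTwo_card_inter_eq_card_compl_inter (T : ι → Finset G) (h2 : SumTwo T) (h4 : Fintype.card ι = 4)
    (s u : G) :
    ((univ.filter fun i => s ∈ T i).filter fun i => u ∈ T i).card
      = ((univ.filter fun i => s ∉ T i).filter fun i => u ∉ T i).card := by
  -- `|{s ∈ T i ∧ u ∈ T i}| + |{s ∈ T i ∧ u ∉ T i}| = |{s ∈ T i}| = 2`
  have e1 := card_filter_add_card_filter_not (s := univ.filter fun i => s ∈ T i) (p := fun i => u ∈ T i)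
  rw [h2 s] at e1
  -- `|{u ∉ T i ∧ s ∈ T i}| + |{u ∉ T i ∧ s ∉ T i}| = |{u ∉ T i}| = 4 − 2`
  have e2 := card_filter_add_card_filter_not (s := univ.filter fun i => u ∉ T i) (p := fun i => s ∈ T i)
  have e3 := card_filter_add_card_filter_not (s := (univ : Finset ι)) (p := fun i => u ∈ T i)
  rw [h2 u, card_univ, h4] at e3
  -- reorder the two double filters
  have r1 : (univ.filter fun i => u ∉ T i).filter (fun i => s ∈ T i)
      = (univ.filter fun i => s ∈ T i).filter fun i => ¬ u ∈ T i := by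
    simp only [filter_filter]
    exact filter_congr fun i _ => and_comm
  have r2 : (univ.filter fun i => u ∉ T i).filter (fun i => ¬ s ∈ T i)
      = (univ.filter fun i => s ∉ T i).filter fun i => u ∉ T i := by
    simp only [filter_filter]
    exact filter_congr fun i _ => and_comm
  rw [r1, r2] at e2
  omega

omit [Fintype G] in
/-- The same statement read with the conjugate embedding: the corners NOT containing `s` are those containing
`c * s`, and «`u ∉ T i`» is «`c * u ∈ T i`» — the form in which the signs of the skew-hermitian lines of the corners
containing `c * s` appear (Liu Def 4.12 for `Φ_{μ_{i, c s}} = (c * s) · (T i)⁻¹`). -/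
theorem sumTwo_card_inter_eq_card_conj {c : G} (T : ι → Finset G) (hT : ∀ i, IsCMType c (T i))
    (h2 : SumTwo T) (h4 : Fintype.card ι = 4) (s u : G) :
    ((univ.filter fun i => s ∈ T i).filter fun i => u ∈ T i).card
      = ((univ.filter fun i => c * s ∈ T i).filter fun i => c * u ∈ T i).card := by
  rw [sumTwo_card_inter_eq_card_compl_inter T h2 h4 s u]
  congr 1
  simp only [filter_filter]
  exact filter_congr fun i _ => by rw [(hT i).conj_mem_iff s, (hT i).conj_mem_iff u]

/-! ### The same count in the language of the corner characters' CM types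

The CM type of the character of corner `i` with eigen-embedding `x` is `x • (T i)⁻¹` (paper note §4.1); its skew-hermitian
line is negative at the embedding `g` iff `g ∈ x • (T i)⁻¹` (Liu Def 4.12).  The two counts of `sumTwo_card_inter_eq_card_conj`
are, in this language, the numbers of negative lines among the corners containing `s` (types `s • (T i)⁻¹`) and among the
corners containing `c * s` (types `(c * s) • (T i)⁻¹`). -/

open scoped Pointwise in
omit [Fintype G] in
/-- `g ∈ x • S⁻¹ ↔ g⁻¹ * x ∈ S`. -/
theorem mem_smul_inv_iff (S : Finset G) (x g : G) : g ∈ x • S⁻¹ ↔ g⁻¹ * x ∈ S := by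
  rw [← Finset.inv_smul_mem_iff, Finset.mem_inv']
  simp [smul_eq_mul, mul_inv_rev]

open scoped Pointwise in
omit [Fintype G] in
/-- **N1's real-place half, in the corner characters' language.**  For a face `T` and embeddings `s`, `g`: the number of
corners `i ∋ s` with `g ∈ s • (T i)⁻¹` equals the number of corners `i ∋ c * s` with `g ∈ (c * s) • (T i)⁻¹`. -/
theorem sumTwo_card_smul_inv {c : G} (hc : IsComplexConj c) (T : ι → Finset G) (hT : ∀ i, IsCMType c (T i))
    (h2 : SumTwo T) (h4 : Fintype.card ι = 4) (s g : G) :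
    ((univ.filter fun i => s ∈ T i).filter fun i => g ∈ s • (T i)⁻¹).card
      = ((univ.filter fun i => c * s ∈ T i).filter fun i => g ∈ (c * s) • (T i)⁻¹).card := by
  have key := sumTwo_card_inter_eq_card_conj T hT h2 h4 s (g⁻¹ * s)
  have e1 : ((univ.filter fun i => s ∈ T i).filter fun i => g ∈ s • (T i)⁻¹)
      = (univ.filter fun i => s ∈ T i).filter fun i => g⁻¹ * s ∈ T i :=
    filter_congr fun i _ => mem_smul_inv_iff (T i) s g
  have e2 : ((univ.filter fun i => c * s ∈ T i).filter fun i => g ∈ (c * s) • (T i)⁻¹)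
      = (univ.filter fun i => c * s ∈ T i).filter fun i => c * (g⁻¹ * s) ∈ T i := by
    refine filter_congr fun i _ => ?_
    rw [mem_smul_inv_iff, ← mul_assoc, ← hc.comm g⁻¹, mul_assoc]
  rw [e1, e2, key]

end T3.SeesawSigns

end HodgeRepro
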